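import Summits.CriticalPhenomena.PercolationContinuityZ3.Theorems.PercNearOneGluingNoHeavyPcintKernNFZ3B8Check1
import Summits.CriticalPhenomena.PercolationContinuityZ3.Theorems.PercNearOneGluingNoHeavyPcintKernNFZ3B8Check2
import Summits.CriticalPhenomena.PercolationContinuityZ3.Theorems.PercNearOneGluingNoHeavyPcintKernNFZ3B8Check3
import Summits.CriticalPhenomena.PercolationContinuityZ3.Theorems.PercNearOneGluingNoHeavyPcintKernNFZ3B8Check4
import Summits.CriticalPhenomena.PercolationContinuityZ3.Theorems.PercNearOneGluingNoHeavyPcintKernNFZ3B8Check5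
import Summits.CriticalPhenomena.PercolationContinuityZ3.Theorems.PercNearOneGluingNoHeavyPcintKernNFZ3B8Check6
import Summits.CriticalPhenomena.PercolationContinuityZ3.Theorems.PercNearOneGluingNoHeavyPcintKernNFZ3B8Check7
import Summits.CriticalPhenomena.PercolationContinuityZ3.Theorems.PercNearOneGluingNoHeavyPcintKernNFZ3B8Check8
import Summits.CriticalPhenomena.PercolationContinuityZ3.Theorems.PercNearOneGluingNoHeavyPcintKernNFZ3B8Check9
import Summits.CriticalPhenomena.PercolationContinuityZ3.Theorems.PercNearOneGluingNoHeavyPcintKernNFZ3B8Check10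
import Summits.CriticalPhenomena.PercolationContinuityZ3.Theorems.PercNearOneGluingNoHeavyPcintKernNFZ3B8Check11
import Summits.CriticalPhenomena.PercolationContinuityZ3.Theorems.PercNearOneGluingNoHeavyPcintKernNFZ3B8Check12
import HarnessLib

/-!
# PCINT lane: `p_c^bond(ℤ³) ≥ 0.2197` (kernel-checked B3r window certificate on normal forms, memory 8 (7-step windows; 6896 first-use normal forms of 279936 codes); printed best lower bound 0.2110 (= site bound; bond: Wierman)).

Cell `prim-pcint`, seat `prim-pcint-2` (gen 2); memo `run/shared/lean/prim/pcint/INTERVAL-PLAN.md` §15.  Does NOT build on p205010.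
Assembles the kernel-checked row blocks (`…KernNFZ3B8Check1..12`), closes the enumeration (`WinK.all_nfCodes_of_nfCodesIn`,
`WinK.allRange_nfOKB_of_nfCodes`) and applies `WinK.le_criticalProb_of_checkBK` (`…PcintWinKernelSymCert`).
No external certificate, no `native_decide`; axioms standard.
-/

namespace Summit.CriticalPhenomena.PercolationContinuityZ3.Theorems.Pcint

open Literature.Probability.Percolation Literature.Probability.LatticeModels NFZ3B8

/-- All Collatz–Wielandt rows on the normal forms of the `279936` window codes check. [folklore] -/
theorem NFZ3B8.chkAll : (WinK.nfCodes 3 7).all (WinK.rowOKBK 3 6 2197 10251 9756 99999 tbl 29242) = true :=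
  WinK.all_nfCodes_of_nfCodesIn (hi := 279936) (WinK.all_of_allB (fuel := 20) (by decide +kernel)) (WinK.all_nfCodesIn_append (WinK.all_nfCodesIn_append (WinK.all_nfCodesIn_append (WinK.all_nfCodesIn_append (WinK.all_nfCodesIn_append (WinK.all_nfCodesIn_append (WinK.all_nfCodesIn_append (WinK.all_nfCodesIn_append (WinK.all_nfCodesIn_append (WinK.all_nfCodesIn_append (WinK.all_nfCodesIn_append chkFile_1 chkFile_2) chkFile_3) chkFile_4) chkFile_5) chkFile_6) chkFile_7) chkFile_8) chkFile_9) chkFile_10) chkFile_11) chkFile_12)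

/-- **`p_c^bond(ℤ³) ≥ 0.2197`** (kernel-checked B3r window certificate on normal forms, memory 8 (7-step windows; 6896 first-use normal forms of 279936 codes); printed best lower bound 0.2110 (= site bound; bond: Wierman)). [folklore] -/
theorem criticalProb_Z3_ge_02197 : (0.2197 : ℝ) ≤ criticalProb (zdGraph 3) 0 := by
  have h := WinK.le_criticalProb_of_checkBK (d := 3) (m := 6) (pn := 2197) (R := 10251) (S := 9756) (lamN := 99999)
      (tbl := tbl) (dflt := 29242) (vlo := 29242) (vhi := 100000) (by norm_num) (by norm_num) (by norm_num) (by norm_num)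
      (by norm_num) (by norm_num) (by norm_num) (by norm_num) tbl_bounds (by norm_num) (by norm_num)
      (WinK.allRange_nfOKB_of_nfCodes chkAll)
  have e : ((2197 : ℕ) : ℝ) / 10 ^ 4 = 0.2197 := by norm_num
  rw [e] at h
  exact h

end Summit.CriticalPhenomena.PercolationContinuityZ3.Theorems.Pcint
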